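import Mathlib.Algebra.Algebra.Operations
import Mathlib.Algebra.Order.Monoid.Unbundled.Pow
import Mathlib.Tactic.Ring
import HarnessLib

/-!
# Venture HSemireg — powers of a hyperplane submodule: degree two already decides

A sharpening of `Summits.Ventures.HSemireg.HyperplanePowers` (seat w1-tw-1 of the computation cell
`pub-hsemireg`; CC note §26.1 (δ) of `widen/W1/CLEAN-COMPONENT-THEOREM-w1tw1.md`), recorded by the
squad's second-code seat w1-tw-2 (`widen/W1/GENPOS-X2-tw2.md` §6, PRECISION P2, adopted by the author):
in a commutative `k`-algebra `A`, for `k`-submodules `S ≤ T ≤ S ⊔ k ∙ e` with `k ∙ e ≤ T`, ONE degree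
decides the next — if `S ^ (n + 2) = T ^ (n + 2)` then `S ^ (n + 3) = T ^ (n + 3)`, because the extra
generator is absorbed:
`(k ∙ e) * S ^ (n + 2) = S * ((k ∙ e) * S ^ (n + 1)) ≤ S * (T * T ^ (n + 1)) = S * S ^ (n + 2)`,
hence `T ^ (n + 3) = T * S ^ (n + 2) ≤ S ^ (n + 3) ⊔ (k ∙ e) * S ^ (n + 2) = S ^ (n + 3)`.
Consequently `S ^ 2 = T ^ 2` ALONE gives `S ^ m = T ^ m` for every `m ≥ 2`; the hypothesis
`S ^ 3 = T ^ 3` of `HyperplanePowers.pow_eq_pow_of_sq_eq_of_cube_eq` is implied. In §26.1 (δ): the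
Hilbert-function value `HF(2) = 11` of the five-plane germ already forces the coincidence with the free
Stanley–Reisner path ring in all degrees; `HF(3) = 16` is a consistency check, not a base case.

* `pow_succ_eq_of_pow_eq` — the one-degree step `S ^ (n + 2) = T ^ (n + 2) → S ^ (n + 3) = T ^ (n + 3)`;
* `cube_eq_of_sq_eq` — `S ^ 2 = T ^ 2 → S ^ 3 = T ^ 3`;
* `pow_eq_pow_of_sq_eq` — `S ^ 2 = T ^ 2 → ∀ m ≥ 2, S ^ m = T ^ m`;
* `pow_eq_pow_of_eq_sup_span_of_sq_eq` — the §26.1 form with `T = S ⊔ k ∙ e`.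

The file is self-contained (Mathlib's `pow_le_pow_left'` for monotonicity, the absorption as a local
step), so that it does not wait for the build of its sibling; it restates none of the sibling's
declarations.

HONEST FRAMING. Elementary manipulation of products of submodules (Mathlib's ordered semiring
structure on `Submodule k A`); no germ, sheaf, abelian variety or semiregularity map appears; nothing
here says that HC, HC_CM or HC_AV holds, and nothing here is a new case of anything.
-/

namespace Summit.Ventures.HSemireg

namespace HyperplanePowersSq

open Submodule

variable {k A : Type*} [CommSemiring k] [CommSemiring A] [Algebra k A]

/-- **One degree decides the next.** If `S ≤ T ≤ S ⊔ k ∙ e`, `k ∙ e ≤ T` and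
`S ^ (n + 2) = T ^ (n + 2)`, then `S ^ (n + 3) = T ^ (n + 3)`. -/
theorem pow_succ_eq_of_pow_eq {S T : Submodule k A} {e : A} (hST : S ≤ T) (he : k ∙ e ≤ T)
    (hTS : T ≤ S ⊔ k ∙ e) (n : ℕ) (hn : S ^ (n + 2) = T ^ (n + 2)) :
    S ^ (n + 3) = T ^ (n + 3) := by
  refine le_antisymm (pow_le_pow_left' hST _) ?_
  -- absorption of the extra generator: (k ∙ e) * S^(n+2) ≤ S^(n+3)
  have habs : (k ∙ e) * S ^ (n + 2) ≤ S ^ (n + 3) := by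
    have h2 : (k ∙ e) * S ^ (n + 1) ≤ S ^ (n + 2) := by
      calc (k ∙ e) * S ^ (n + 1) ≤ T * T ^ (n + 1) := mul_le_mul' he (pow_le_pow_left' hST _)
        _ = T ^ (n + 2) := by ring
        _ = S ^ (n + 2) := hn.symm
    calc (k ∙ e) * S ^ (n + 2) = S * ((k ∙ e) * S ^ (n + 1)) := by ring
      _ ≤ S * S ^ (n + 2) := mul_le_mul' le_rfl h2
      _ = S ^ (n + 3) := by ring
  calc T ^ (n + 3) = T * T ^ (n + 2) := by ring
    _ = T * S ^ (n + 2) := by rw [hn]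
    _ ≤ (S ⊔ k ∙ e) * S ^ (n + 2) := mul_le_mul' hTS le_rfl
    _ = S * S ^ (n + 2) ⊔ (k ∙ e) * S ^ (n + 2) := sup_mul _ _ _
    _ ≤ S ^ (n + 3) := sup_le (le_of_eq (by ring)) habs

/-- Degree two decides degree three: `S ^ 2 = T ^ 2 → S ^ 3 = T ^ 3` under the standing hypotheses
(so the cube hypothesis of `HyperplanePowers.pow_eq_pow_of_sq_eq_of_cube_eq` is redundant). -/
theorem cube_eq_of_sq_eq {S T : Submodule k A} {e : A} (hST : S ≤ T) (he : k ∙ e ≤ T)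
    (hTS : T ≤ S ⊔ k ∙ e) (h2 : S ^ 2 = T ^ 2) : S ^ 3 = T ^ 3 :=
  pow_succ_eq_of_pow_eq hST he hTS 0 h2

/-- **Degree two decides all.** In a commutative `k`-algebra, if `S ≤ T ≤ S ⊔ k ∙ e` with
`k ∙ e ≤ T` and `S ^ 2 = T ^ 2`, then `S ^ m = T ^ m` for every `m ≥ 2`. -/
theorem pow_eq_pow_of_sq_eq {S T : Submodule k A} {e : A} (hST : S ≤ T) (he : k ∙ e ≤ T)
    (hTS : T ≤ S ⊔ k ∙ e) (h2 : S ^ 2 = T ^ 2) : ∀ m, 2 ≤ m → S ^ m = T ^ m := by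
  have key : ∀ n, S ^ (n + 2) = T ^ (n + 2) := by
    intro n
    induction n with
    | zero => exact h2
    | succ n ih => exact pow_succ_eq_of_pow_eq hST he hTS n ih
  intro m hm
  obtain ⟨n, rfl⟩ := Nat.exists_eq_add_of_le hm
  rw [add_comm]
  exact key n

/-- The CC note §26.1 (δ) form with `T = S ⊔ k ∙ e` and only the degree-two hypothesis:
`S ^ 2 = T ^ 2` forces `S ^ m = T ^ m` for all `m ≥ 2`. -/
theorem pow_eq_pow_of_eq_sup_span_of_sq_eq {S T : Submodule k A} {e : A} (hT : T = S ⊔ k ∙ e)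
    (h2 : S ^ 2 = T ^ 2) (m : ℕ) (hm : 2 ≤ m) : S ^ m = T ^ m :=
  pow_eq_pow_of_sq_eq (hT ▸ le_sup_left) (hT ▸ le_sup_right) hT.le h2 m hm

end HyperplanePowersSq

end Summit.Ventures.HSemireg
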